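import Summits.Parity.GeneralizedHardyLittlewood.Theorems.PrimeLevelFamEdgeMomentsBeyondDiagonalDiagRemThreeThreeBose
import HarnessLib

/-!
# Route `PrimeLevelFamEdge`, crux K_A `MomentsBeyondDiagonal` (stmt-Parity-20007), line «petersson_layers» v4, stub `stub_diag`:
# **the continued Bose remainders `r₁₄, r₂₄` of ORDER `(2,4)` in `Π`-form (moments `μ₂, μ₄, μ₆` explicit), two-sequence Abel
# estimate with the common envelope `9C₀(1+|log 2αY²|)⁸`** (first bricks of the remainder estimate (R₂₄))

The order-`(2,4)` piece of `stub_diag` (rung `N = 4`) is reduced to the single remainder estimate (R₂₄) by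
`…DiagOrderTwoFourOfR24.orderTwoFour_target_of_remainder` (lineage famedge-2 g7; (Poly₂₄) and (M4P2) discharged). (R₂₄) carries the
FIFTEEN kernels `r_ab`, `a ≤ 2`, `b ≤ 4`; thirteen are in the tree in `Π`-form (`…DiagRemThreeThreeKernelsAll.twoSeq_sixteen₃₃`:
`a, b ≤ 3`; `…DiagRemZeroFourBose`: `r₀₄`). This file adds the two missing ones, in exactly the `Π`-form printed in the hypothesis `hR`
of the order-`(2,4)` target:

* `abs_doubleSum_rem_le₂₄b` — **`Π₁₄ = −L⁶/384 − (μ₂/8)L⁴ + (3μ₄/2)L² + E₁₄`, `Π₂₄ = L⁷/896 − (μ₂/40)L⁵ − (μ₄/6)L³ + 2μ₆L + E₂₄`**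
  (`μ_m = ∫₀¹logᵐv·v/(1+v²)²`, `μ₀ = 1/4`; from the generic `…DiagRemBoseTwoSeq.abs_doubleSum_bose_rem_le₂ a b`, the odd moments
  cancel), two two-sequence Abel estimates with common `C₀` and the envelope `9C₀(1+|log 2αY²|)⁸` (`a + b + 1 ≤ 7`,
  `…DiagRemThreeThreeBose.weaken_second_term8`).

Def-free; theorems only. Helper `--supports stmt-Parity-20007`; closes nothing (the bundling `twoSeq_fifteen₂₄`, bricks B3–B5 of (R₂₄),
the order `(4,4)` and `stub_rung/core/band/farP` remain); K_A, K_B and the Parity summit are NOT proved; nothing about Landau–Siegel zeros.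

## References
* E. Kowalski, P. Michel, J. VanderKam, J. reine angew. Math. 526 (2000), (22)–(28) pp. 12–15 and Prop. 5.1 p. 18.
  [cite: KowalskiMichelVanderKam2000, (22)–(28) and Prop. 5.1 — derivation (corner of the diagonal, general Q, order (2,4))]
-/

noncomputable section

open Real MeasureTheory Finset

namespace Summit.Parity.GeneralizedHardyLittlewood.Theorems.MomentsBeyondDiagonal.DiagCorner

open Summit.Parity.GeneralizedHardyLittlewood.Theorems.BeyondDiagonalBeatsQuarter.Corner
open Summit.Parity.GeneralizedHardyLittlewood.Theorems.MomentsBeyondDiagonal.DiagLines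

set_option maxHeartbeats 1600000 in
-- two large kernel statements
/-- **THE CONTINUED BOSE REMAINDERS `r₁₄, r₂₄` IN `Π`-FORM (moments `μ₂, μ₄, μ₆` explicit), TWO-SEQUENCE ABEL ESTIMATE WITH THE
COMMON ENVELOPE `9C₀(1+|log 2αY²|)⁸`.**
[cite: KowalskiMichelVanderKam2000, (22)–(28) and Prop. 5.1 — derivation (corner of the diagonal, general Q, order (2,4))] -/
theorem abs_doubleSum_rem_le₂₄b : ∃ E₁₄ E₂₄ C₀ : ℝ, 0 ≤ C₀ ∧
    ∀ (a₁ a₂ : ℕ → ℝ) (Y α B η : ℝ) (K₁ i j : ℕ), 1 ≤ Y → 0 < α → 1 ≤ i → 1 ≤ j →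
      (∀ e : ℕ, e ≤ ⌊Y⌋₊ → |∑ k ∈ Icc 1 e, a₂ k| ≤ B) → (∀ e : ℕ, K₁ ≤ e → |∑ k ∈ Icc 1 e, a₁ k| ≤ η) →
      2 * α * K₁ * Y ≤ 1 →
    |∑ k₁ ∈ Icc 1 ⌊Y⌋₊, ∑ k₂ ∈ Icc 1 ⌊Y⌋₊,
        a₁ k₁ * a₂ k₂ * ellp Y k₁ ^ i * ellp Y k₂ ^ j *
          ((∫ u₁ in Set.Ioi (0 : ℝ), Real.log u₁ * ∫ u₂ in Set.Ioi ((α * k₁ * k₂) / u₁),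
              Real.exp (-(u₁ + u₂)) / (1 - Real.exp (-(u₁ + u₂))) ^ 2 * Real.log u₂ ^ 4) -
            (-(Real.log (1 / (α * k₁ * k₂)) ^ 6) / 384 - (∫ v in Set.Ioc (0 : ℝ) 1, Real.log v ^ 2 * (v / (1 + v ^ 2) ^ 2)) / 8 * Real.log (1 / (α * k₁ * k₂)) ^ 4 + 3 * (∫ v in Set.Ioc (0 : ℝ) 1, Real.log v ^ 4 * (v / (1 + v ^ 2) ^ 2)) / 2 * Real.log (1 / (α * k₁ * k₂)) ^ 2 + E₁₄))| ≤
      (∑ k ∈ Icc 1 ⌊Y⌋₊, |a₁ k| * ellp Y k ^ i) * (B * (Real.log Y ^ j * (3 * C₀ * Real.sqrt (2 * α * K₁ * Y)))) +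
        (∑ k ∈ Icc 1 ⌊Y⌋₊, |a₂ k| * ellp Y k ^ j) *
          ((2 * η) * (Real.log Y ^ i * (9 * C₀ * (1 + |Real.log (2 * α * Y ^ 2)|) ^ 8))) ∧
    |∑ k₁ ∈ Icc 1 ⌊Y⌋₊, ∑ k₂ ∈ Icc 1 ⌊Y⌋₊,
        a₁ k₁ * a₂ k₂ * ellp Y k₁ ^ i * ellp Y k₂ ^ j *
          ((∫ u₁ in Set.Ioi (0 : ℝ), Real.log u₁ ^ 2 * ∫ u₂ in Set.Ioi ((α * k₁ * k₂) / u₁),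
              Real.exp (-(u₁ + u₂)) / (1 - Real.exp (-(u₁ + u₂))) ^ 2 * Real.log u₂ ^ 4) -
            (Real.log (1 / (α * k₁ * k₂)) ^ 7 / 896 - (∫ v in Set.Ioc (0 : ℝ) 1, Real.log v ^ 2 * (v / (1 + v ^ 2) ^ 2)) / 40 * Real.log (1 / (α * k₁ * k₂)) ^ 5 - (∫ v in Set.Ioc (0 : ℝ) 1, Real.log v ^ 4 * (v / (1 + v ^ 2) ^ 2)) / 6 * Real.log (1 / (α * k₁ * k₂)) ^ 3 + 2 * (∫ v in Set.Ioc (0 : ℝ) 1, Real.log v ^ 6 * (v / (1 + v ^ 2) ^ 2)) * Real.log (1 / (α * k₁ * k₂)) + E₂₄))| ≤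
      (∑ k ∈ Icc 1 ⌊Y⌋₊, |a₁ k| * ellp Y k ^ i) * (B * (Real.log Y ^ j * (3 * C₀ * Real.sqrt (2 * α * K₁ * Y)))) +
        (∑ k ∈ Icc 1 ⌊Y⌋₊, |a₂ k| * ellp Y k ^ j) *
          ((2 * η) * (Real.log Y ^ i * (9 * C₀ * (1 + |Real.log (2 * α * Y ^ 2)|) ^ 8))) := by
  obtain ⟨C₁₄, hC₁₄, h₁₄⟩ := abs_doubleSum_bose_rem_le₂ 1 4
  obtain ⟨C₂₄, hC₂₄, h₂₄⟩ := abs_doubleSum_bose_rem_le₂ 2 4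
  set C₀ : ℝ := max C₁₄ C₂₄ with hC₀
  have e₁₄ : C₁₄ ≤ C₀ := le_max_left _ _
  have e₂₄ : C₂₄ ≤ C₀ := le_max_right _ _
  have hC₀0 : 0 ≤ C₀ := hC₁₄.trans e₁₄
  refine ⟨((∫ u₁ in Set.Ioi (0 : ℝ), Real.log u₁ ^ 1 * ∫ u₂ in Set.Ioi (1 / u₁),
        Real.exp (-(u₁ + u₂)) / (1 - Real.exp (-(u₁ + u₂))) ^ 2 * Real.log u₂ ^ 4) +
      (∫ η in Set.Ioc (0 : ℝ) 1, (η * (∫ u in Set.Ioi (0 : ℝ), Real.log u ^ 1 * Real.log (η / u) ^ 4 *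
            (Real.exp (-(u + η / u)) / (1 - Real.exp (-(u + η / u))) ^ 2) / u) -
          ∫ v in Set.Ioc (0 : ℝ) 1, ((-(Real.log (1 / η) / 2) + Real.log v) ^ 1 * (-(Real.log (1 / η) / 2) - Real.log v) ^ 4 +
              (-(Real.log (1 / η) / 2) - Real.log v) ^ 1 * (-(Real.log (1 / η) / 2) + Real.log v) ^ 4) *
            (v / (1 + v ^ 2) ^ 2)) / η)),
    ((∫ u₁ in Set.Ioi (0 : ℝ), Real.log u₁ ^ 2 * ∫ u₂ in Set.Ioi (1 / u₁),
        Real.exp (-(u₁ + u₂)) / (1 - Real.exp (-(u₁ + u₂))) ^ 2 * Real.log u₂ ^ 4) +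
      (∫ η in Set.Ioc (0 : ℝ) 1, (η * (∫ u in Set.Ioi (0 : ℝ), Real.log u ^ 2 * Real.log (η / u) ^ 4 *
            (Real.exp (-(u + η / u)) / (1 - Real.exp (-(u + η / u))) ^ 2) / u) -
          ∫ v in Set.Ioc (0 : ℝ) 1, ((-(Real.log (1 / η) / 2) + Real.log v) ^ 2 * (-(Real.log (1 / η) / 2) - Real.log v) ^ 4 +
              (-(Real.log (1 / η) / 2) - Real.log v) ^ 2 * (-(Real.log (1 / η) / 2) + Real.log v) ^ 4) *
            (v / (1 + v ^ 2) ^ 2)) / η)),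
    C₀, hC₀0, fun a₁ a₂ Y α B η K₁ i j hY hα hi hj hB hη hY₁ ↦ ?_⟩
  have hY0 : 0 < Y := by linarith
  have hη0 : 0 ≤ η := (abs_nonneg _).trans (hη K₁ le_rfl)
  have hLY : 0 ≤ Real.log Y := Real.log_nonneg hY
  have hx : (1 : ℝ) ≤ 1 + |Real.log (2 * α * Y ^ 2)| := by linarith [abs_nonneg (Real.log (2 * α * Y ^ 2))]
  have hSj : 0 ≤ ∑ k ∈ Icc 1 ⌊Y⌋₊, |a₂ k| * ellp Y k ^ j :=
    Finset.sum_nonneg fun k _ ↦ mul_nonneg (abs_nonneg _) (pow_nonneg (ellp_nonneg Y k) j)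
  have hSi : 0 ≤ ∑ k ∈ Icc 1 ⌊Y⌋₊, |a₁ k| * ellp Y k ^ i :=
    Finset.sum_nonneg fun k _ ↦ mul_nonneg (abs_nonneg _) (pow_nonneg (ellp_nonneg Y k) i)
  have hB0 : 0 ≤ B := (abs_nonneg _).trans (hB 0 (Nat.zero_le _))
  have hsq : 0 ≤ Real.sqrt (2 * α * K₁ * Y) := Real.sqrt_nonneg _
  have hc42 : Nat.choose 4 2 = 6 := by decide
  have hc43 : Nat.choose 4 3 = 4 := by decide
  have hfirst : ∀ {C : ℝ}, C ≤ C₀ →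
      (∑ k ∈ Icc 1 ⌊Y⌋₊, |a₁ k| * ellp Y k ^ i) * (B * (Real.log Y ^ j * (3 * C * Real.sqrt (2 * α * K₁ * Y)))) ≤
      (∑ k ∈ Icc 1 ⌊Y⌋₊, |a₁ k| * ellp Y k ^ i) * (B * (Real.log Y ^ j * (3 * C₀ * Real.sqrt (2 * α * K₁ * Y)))) := by
    intro C hC
    have hLj : 0 ≤ Real.log Y ^ j := pow_nonneg hLY j
    gcongr
  have hsecond : ∀ {C : ℝ} {N : ℕ}, 0 ≤ C → C ≤ C₀ →
      (∑ k ∈ Icc 1 ⌊Y⌋₊, |a₂ k| * ellp Y k ^ j) * ((2 * η) * (Real.log Y ^ i *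
          (3 * (C + C * (1 + |Real.log (2 * α * Y ^ 2)|) ^ N) + 2 * C +
            C * (1 + |Real.log (2 * α * Y ^ 2)|) ^ N * (1 + |Real.log (2 * α * Y ^ 2)|)))) ≤
      (∑ k ∈ Icc 1 ⌊Y⌋₊, |a₂ k| * ellp Y k ^ j) * ((2 * η) * (Real.log Y ^ i *
          (3 * (C₀ + C₀ * (1 + |Real.log (2 * α * Y ^ 2)|) ^ N) + 2 * C₀ +
            C₀ * (1 + |Real.log (2 * α * Y ^ 2)|) ^ N * (1 + |Real.log (2 * α * Y ^ 2)|)))) := by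
    intro C N hC hCC
    have hLi : 0 ≤ Real.log Y ^ i := pow_nonneg hLY i
    have hxN : 0 ≤ (1 + |Real.log (2 * α * Y ^ 2)|) ^ N := pow_nonneg (by positivity) N
    gcongr
  refine ⟨?_, ?_⟩
  · have h := h₁₄ a₁ a₂ Y α B η K₁ i j hY hα hi hj hB hη hY₁
    have h' := le_trans h (add_le_add (hfirst e₁₄) (hsecond hC₁₄ e₁₄))
    have h'' := weaken_second_term8 hSj hη0 hLY hC₀0 hx (by norm_num : 1 + 4 + 1 ≤ 7) h'
    refine le_trans (le_of_eq ?_) h''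
    congr 1
    refine Finset.sum_congr rfl fun k₁ _ ↦ Finset.sum_congr rfl fun k₂ _ ↦ ?_
    simp only [Finset.sum_range_succ, Finset.sum_range_zero, zero_add, add_zero, Nat.choose_self,
      Nat.choose_zero_right, Nat.choose_one_right, hc42, hc43, Nat.cast_one, Nat.cast_ofNat, Nat.sub_self, Nat.sub_zero,
      Nat.reduceSub, Nat.reduceAdd, Nat.cast_zero, Nat.cast_add, pow_zero, pow_one, one_mul, mul_one,
      integral_model_weight_Ioc]
    ring
  · have h := h₂₄ a₁ a₂ Y α B η K₁ i j hY hα hi hj hB hη hY₁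
    have h' := le_trans h (add_le_add (hfirst e₂₄) (hsecond hC₂₄ e₂₄))
    have h'' := weaken_second_term8 hSj hη0 hLY hC₀0 hx (by norm_num : 2 + 4 + 1 ≤ 7) h'
    refine le_trans (le_of_eq ?_) h''
    congr 1
    refine Finset.sum_congr rfl fun k₁ _ ↦ Finset.sum_congr rfl fun k₂ _ ↦ ?_
    simp only [Finset.sum_range_succ, Finset.sum_range_zero, zero_add, add_zero, Nat.choose_self,
      Nat.choose_zero_right, Nat.choose_one_right, hc42, hc43, Nat.cast_one, Nat.cast_ofNat, Nat.sub_self, Nat.sub_zero,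
      Nat.reduceSub, Nat.reduceAdd, Nat.cast_zero, Nat.cast_add, pow_zero, pow_one, one_mul, mul_one,
      integral_model_weight_Ioc]
    ring

end Summit.Parity.GeneralizedHardyLittlewood.Theorems.MomentsBeyondDiagonal.DiagCorner

end
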